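import Mathlib
import Summits.Ventures.PercRepro2.Defs
import Summits.Ventures.PercRepro2.Graph
import Summits.Ventures.PercRepro2.OneColourSwitch
import Summits.Ventures.PercRepro2.RegionHubSign
import Summits.Ventures.PercRepro2.SideSwitch
import Summits.Ventures.PercRepro2.SideSwitchFibre
import Summits.Ventures.PercRepro2.SideSwitchClosed
import Summits.Ventures.PercRepro2.SideSwitchComps
import Summits.Ventures.PercRepro2.SideSwitchCompsFibre
import Summits.Ventures.PercRepro2.TermSwitchDefs
import Summits.Ventures.PercRepro2.TermSwitchFibre
import Summits.Ventures.PercRepro2.TermSwitchCompsFibre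
import Summits.Ventures.PercRepro2.TermSwitchMono
import Summits.Ventures.PercRepro2.TermSwitchM9
import Summits.Ventures.PercRepro2.TermSwitchRestrict
import Summits.Ventures.PercRepro2.TermSwitchReach
import Summits.Ventures.PercRepro2.M9NoPocketDefs
import Summits.Ventures.PercRepro2.M9NoPocketWorld
import Summits.Ventures.PercRepro2.M9NoPocketWorldD
import Summits.Ventures.PercRepro2.M9NoPocketFibre
import Summits.Ventures.PercRepro2.M9PocketUnit

/-!
# The `G − d` unit is a union of fibres of the three-terminal fibration (blind cell PercRepro2,
p3 g38, 2026-08-29; `proofs/P3-POCKETRK.md` §5‴ (b), kernel plan K1–K3)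

The UNIT of a colouring `ω` (the `U1` unit of `proofs/P3-NPHDR.md` §3′) is determined by its
`G − d` representative: the colouring `nu (endsD ends d) r s ω` — every `W`-side vertex of the
worlds of `{r, s}` in `G − d` switched to the `Y`-side — restricted to the edges TOUCHING those
worlds (`K2 ∪ M2` of `G − d`; the edges at `d`, the block sides and the edges inside the outside
are the free coordinates).  «`ω` lies in the unit of `ρ₀`» is the predicate
`∀ e ∈ touches (endsD ends d) (K2 ∪ M2), nu (endsD ends d) r s ω e = ρ₀ e` (stated inline).

For the terminal set `H = {r, s, d}` the unit predicate is constant along the component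
assignments of every representative (`unit_assignC_iff`) and invariant under the outside flip
(`unit_flipOH_iff`): an `H`-component contains every `G − d` block it meets (`M9PocketUnit`),
so on the edges touching the `G − d` worlds the switch of a set of `H`-components is the switch
of the `G − d` blocks inside it (`SideSwitchClosed` in `G − d`: `K2_endsD_assignC_triple`,
`M2_endsD_assignC_triple`, `Bside_endsD_assignC_triple`), which the normalisation `nu` undoes
(`nu_endsD_assignC`); the outside flip touches no such edge (`flipOH_eq_on_touches_U2`).
Hence (`TermSwitchRestrict`) the three-terminal sum over the `L`-class of a unit is
non-positive (`dzeroSignSumHP_unit_nonpos`, `dzeroSignSumHP_reached_unit_nonpos`): the lane's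
three-terminal theorem INSIDE a unit — `proofs/P3-POCKETRK.md` §5‴ (b), the `L`-part of the
same-type sum.  Own work; std axioms.
-/

namespace Summit.Ventures.PercRepro2

namespace NoPocket

open Finset Classical RegionHub OneColourSwitch SideSwitch TermSwitch

variable {V : Type*} {E : Type*}

section Fibre

variable [Fintype V] [DecidableEq V] {ends : E → Sym2 V} {p q r s d : V}

variable [Fintype E] [DecidableEq E]

/-- The block switch of `G − d` inside a union of `H`-components, as a colouring of `G − d`. -/
lemma assignC_eq_flipTouch_endsD_on_touches (hr : d ≠ r) (hs : d ≠ s) {T : Finset (Finset V)}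
    {ρ : Config E} (hρ : ρ ∈ RepH ends p q ({r, s, d} : Set V))
    (hT : T ⊆ compsH ends ({r, s, d} : Set V) ρ) {e : E}
    (he : e ∈ touches (endsD ends d) (K2 (endsD ends d) r s ρ ∪ M2 (endsD ends d) r s ρ)) :
    assignC ends T ρ e =
      flipTouch (endsD ends d) (↑(unionT T ∩ A0 (endsD ends d) r s ρ) : Set V) ρ e := by
  have hde : d ∉ ends e := d_notMem_of_mem_touches_U2 hr hs he
  have hsep : sep2 (endsD ends d) p q r s ρ := sep2_endsD_of_sep2 (d := d)
    (sep2_of_sepH (r_mem_triple r s d) (s_mem_triple r s d) (mem_RepH.1 hρ).1)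
  simp only [assignC, assign, flipTouch, mem_touches_endsD_iff hde]
  rw [mem_touches_unionT_iff hr hs hsep hT he]

/-- The worlds of `{r, s}` in `G − d` after the switch of a union of `H`-components: the
`G − d` blocks inside the union change side (`SideSwitchClosed` in `G − d`). -/
lemma K2_endsD_assignC_triple (hr : d ≠ r) (hs : d ≠ s) {T : Finset (Finset V)}
    {ρ : Config E} (hρ : ρ ∈ RepH ends p q ({r, s, d} : Set V))
    (hT : T ⊆ compsH ends ({r, s, d} : Set V) ρ) :
    K2 (endsD ends d) r s (assignC ends T ρ) =
      K2 (endsD ends d) r s ρ \ (↑(unionT T ∩ A0 (endsD ends d) r s ρ) : Set V) := by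
  set C' : Finset V := unionT T ∩ A0 (endsD ends d) r s ρ with hC'
  have hsep : sep2 (endsD ends d) p q r s ρ := sep2_endsD_of_sep2 (d := d)
    (sep2_of_sepH (r_mem_triple r s d) (s_mem_triple r s d) (mem_RepH.1 hρ).1)
  obtain ⟨hC, hCr, hCs⟩ := subset_U2_of_subset_A0 (ends := endsD ends d) (r := r) (s := s)
    (ω := ρ) (T := C') Finset.inter_subset_right
  have hcl := closedIn_unionT_inter_A0 (ends := ends) hr hs hT
  have hK := K2_flipTouch_of_closed hsep hC hCr hCs hcl
  have hU := U2_flipTouch_of_closed hsep hC hCr hCs hcl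
  -- the two colourings agree on the edges touching the worlds of the switched colouring
  have hagree : ∀ e ∈ touches (endsD ends d)
      (K2 (endsD ends d) r s (flipTouch (endsD ends d) (↑C' : Set V) ρ)),
      flipTouch (endsD ends d) (↑C' : Set V) ρ e = assignC ends T ρ e := by
    intro e he
    refine (assignC_eq_flipTouch_endsD_on_touches hr hs hρ hT ?_).symm
    obtain ⟨x, hx, y, hxy⟩ := he
    refine ⟨x, ?_, y, hxy⟩
    rw [← hU]
    exact Or.inl hx
  have h1 : K2 (endsD ends d) r s (assignC ends T ρ) =
      K2 (endsD ends d) r s (flipTouch (endsD ends d) (↑C' : Set V) ρ) :=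
    expl_eq_of_eqOn_touches hagree
  rw [h1, hK]
  -- `C' ∩ M₂ = ∅`: the `W`-side of a representative is empty
  have hCM : (↑C' : Set V) ∩ M2 (endsD ends d) r s ρ = ∅ := by
    ext x
    simp only [Set.mem_inter_iff, Finset.mem_coe, Set.mem_empty_iff_false, iff_false, not_and]
    intro hx hxM
    obtain ⟨_, hxr, hxs⟩ := mem_A0.1 (Finset.mem_inter.1 hx).2
    have : x ∈ Bside (endsD ends d) r s ρ := mem_Bside.2 ⟨hxM, hxr, hxs⟩
    rw [Bside_endsD_eq_empty_of_mem_RepH hr hs hρ] at this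
    simp at this
  rw [hCM, Set.union_empty]

/-- The `W`-world of `{r, s}` in `G − d` after the switch of a union of `H`-components. -/
lemma M2_endsD_assignC_triple (hr : d ≠ r) (hs : d ≠ s) {T : Finset (Finset V)}
    {ρ : Config E} (hρ : ρ ∈ RepH ends p q ({r, s, d} : Set V))
    (hT : T ⊆ compsH ends ({r, s, d} : Set V) ρ) :
    M2 (endsD ends d) r s (assignC ends T ρ) =
      M2 (endsD ends d) r s ρ ∪ (↑(unionT T ∩ A0 (endsD ends d) r s ρ) : Set V) := by
  set C' : Finset V := unionT T ∩ A0 (endsD ends d) r s ρ with hC'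
  have hsep : sep2 (endsD ends d) p q r s ρ := sep2_endsD_of_sep2 (d := d)
    (sep2_of_sepH (r_mem_triple r s d) (s_mem_triple r s d) (mem_RepH.1 hρ).1)
  obtain ⟨hC, hCr, hCs⟩ := subset_U2_of_subset_A0 (ends := endsD ends d) (r := r) (s := s)
    (ω := ρ) (T := C') Finset.inter_subset_right
  have hcl := closedIn_unionT_inter_A0 (ends := ends) hr hs hT
  have hM := M2_flipTouch_of_closed hsep hC hCr hCs hcl
  have hU := U2_flipTouch_of_closed hsep hC hCr hCs hcl
  have hagree : ∀ e ∈ touches (endsD ends d)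
      (M2 (endsD ends d) r s (flipTouch (endsD ends d) (↑C' : Set V) ρ)),
      OneColourSwitch.compl (flipTouch (endsD ends d) (↑C' : Set V) ρ) e =
        OneColourSwitch.compl (assignC ends T ρ) e := by
    intro e he
    simp only [OneColourSwitch.compl]
    rw [assignC_eq_flipTouch_endsD_on_touches hr hs hρ hT ?_]
    obtain ⟨x, hx, y, hxy⟩ := he
    refine ⟨x, ?_, y, hxy⟩
    rw [← hU]
    exact Or.inr hx
  have h1 : M2 (endsD ends d) r s (assignC ends T ρ) =
      M2 (endsD ends d) r s (flipTouch (endsD ends d) (↑C' : Set V) ρ) :=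
    expl_eq_of_eqOn_touches hagree
  rw [h1, hM]
  -- `C' ⊆ K₂` and `C' ∩ M₂ = ∅`
  have hCK : (↑C' : Set V) ∩ K2 (endsD ends d) r s ρ = (↑C' : Set V) := by
    ext x
    simp only [Set.mem_inter_iff, Finset.mem_coe, and_iff_left_iff_imp]
    intro hx
    exact A0_endsD_subset_K2_of_mem_RepH hr hs hρ (Finset.mem_inter.1 hx).2
  have hMC : M2 (endsD ends d) r s ρ \ (↑C' : Set V) = M2 (endsD ends d) r s ρ := by
    ext x
    simp only [Set.mem_sdiff, Finset.mem_coe, and_iff_left_iff_imp]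
    intro hxM hx
    obtain ⟨_, hxr, hxs⟩ := mem_A0.1 (Finset.mem_inter.1 hx).2
    have : x ∈ Bside (endsD ends d) r s ρ := mem_Bside.2 ⟨hxM, hxr, hxs⟩
    rw [Bside_endsD_eq_empty_of_mem_RepH hr hs hρ] at this
    simp at this
  rw [hCK, hMC]

/-- The worlds of `{r, s}` in `G − d` (as a set) are preserved by the switch of a union of
`H`-components. -/
lemma U2_endsD_assignC (hr : d ≠ r) (hs : d ≠ s) {T : Finset (Finset V)}
    {ρ : Config E} (hρ : ρ ∈ RepH ends p q ({r, s, d} : Set V))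
    (hT : T ⊆ compsH ends ({r, s, d} : Set V) ρ) :
    K2 (endsD ends d) r s (assignC ends T ρ) ∪ M2 (endsD ends d) r s (assignC ends T ρ) =
      K2 (endsD ends d) r s ρ ∪ M2 (endsD ends d) r s ρ := by
  rw [K2_endsD_assignC_triple hr hs hρ hT, M2_endsD_assignC_triple hr hs hρ hT]
  ext x
  simp only [Set.mem_union, Set.mem_sdiff, Finset.mem_coe]
  constructor
  · rintro (⟨hx, _⟩ | (hx | hx))
    · exact Or.inl hx
    · exact Or.inr hx
    · exact Or.inl (A0_endsD_subset_K2_of_mem_RepH hr hs hρ (Finset.mem_inter.1 hx).2)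
  · rintro (hx | hx)
    · by_cases hxC : x ∈ unionT T ∩ A0 (endsD ends d) r s ρ
      · exact Or.inr (Or.inr hxC)
      · exact Or.inl ⟨hx, hxC⟩
    · exact Or.inr (Or.inl hx)

/-- The `W`-side of `G − d` after the switch of a union of `H`-components is the set of `G − d`
blocks inside it. -/
lemma Bside_endsD_assignC_triple (hr : d ≠ r) (hs : d ≠ s) {T : Finset (Finset V)}
    {ρ : Config E} (hρ : ρ ∈ RepH ends p q ({r, s, d} : Set V))
    (hT : T ⊆ compsH ends ({r, s, d} : Set V) ρ) :
    Bside (endsD ends d) r s (assignC ends T ρ) = unionT T ∩ A0 (endsD ends d) r s ρ := by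
  ext x
  rw [mem_Bside, M2_endsD_assignC_triple hr hs hρ hT]
  simp only [Set.mem_union, Finset.mem_coe]
  constructor
  · rintro ⟨hx | hx, hxr, hxs⟩
    · have : x ∈ Bside (endsD ends d) r s ρ := mem_Bside.2 ⟨hx, hxr, hxs⟩
      rw [Bside_endsD_eq_empty_of_mem_RepH hr hs hρ] at this
      simp at this
    · exact hx
  · intro hx
    obtain ⟨_, hxr, hxs⟩ := mem_A0.1 (Finset.mem_inter.1 hx).2
    exact ⟨Or.inr hx, hxr, hxs⟩

/-- **The normalisation undoes the switch**: on the edges touching the worlds of `{r, s}` in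
`G − d`, the `G − d` representative of `assignC T ρ` is `ρ`. -/
lemma nu_endsD_assignC (hr : d ≠ r) (hs : d ≠ s) {T : Finset (Finset V)}
    {ρ : Config E} (hρ : ρ ∈ RepH ends p q ({r, s, d} : Set V))
    (hT : T ⊆ compsH ends ({r, s, d} : Set V) ρ) {e : E}
    (he : e ∈ touches (endsD ends d) (K2 (endsD ends d) r s ρ ∪ M2 (endsD ends d) r s ρ)) :
    nu (endsD ends d) r s (assignC ends T ρ) e = ρ e := by
  unfold nu
  rw [Bside_endsD_assignC_triple hr hs hρ hT]
  have h1 := assignC_eq_flipTouch_endsD_on_touches hr hs hρ hT he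
  by_cases hc : e ∈ touches (endsD ends d) (↑(unionT T ∩ A0 (endsD ends d) r s ρ) : Set V)
  · rw [flipTouch_of_mem _ hc, h1, flipTouch_of_mem _ hc, Bool.not_not]
  · rw [flipTouch_of_notMem _ hc, h1, flipTouch_of_notMem _ hc]

/-- **The unit predicate is constant along the component assignments of a representative.** -/
theorem unit_assignC_iff (hr : d ≠ r) (hs : d ≠ s) (ρ₀ : Config E) {T : Finset (Finset V)}
    {ρ : Config E} (hρ : ρ ∈ RepH ends p q ({r, s, d} : Set V))
    (hT : T ⊆ compsH ends ({r, s, d} : Set V) ρ) :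
    (∀ e ∈ touches (endsD ends d) (K2 (endsD ends d) r s (assignC ends T ρ) ∪
        M2 (endsD ends d) r s (assignC ends T ρ)),
        nu (endsD ends d) r s (assignC ends T ρ) e = ρ₀ e) ↔
      ∀ e ∈ touches (endsD ends d) (K2 (endsD ends d) r s ρ ∪ M2 (endsD ends d) r s ρ),
        nu (endsD ends d) r s ρ e = ρ₀ e := by
  rw [U2_endsD_assignC hr hs hρ hT, nu_endsD_eq_of_mem_RepH hr hs hρ]
  constructor
  · intro h e he
    rw [← nu_endsD_assignC hr hs hρ hT he]
    exact h e he
  · intro h e he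
    rw [nu_endsD_assignC hr hs hρ hT he]
    exact h e he

omit [Fintype V] [DecidableEq V] [Fintype E] [DecidableEq E] in
/-- The outside flip of the terminal set `{r, s, d}` fixes every edge touching the worlds of
`{r, s}` in `G − d`. -/
lemma flipOH_eq_on_touches_U2 (hr : d ≠ r) (hs : d ≠ s) (ρ : Config E) {e : E}
    (he : e ∈ touches (endsD ends d) (K2 (endsD ends d) r s ρ ∪ M2 (endsD ends d) r s ρ)) :
    flipOH ends ({r, s, d} : Set V) ρ e = ρ e := by
  have hde : d ∉ ends e := d_notMem_of_mem_touches_U2 hr hs he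
  obtain ⟨x, hx, y, hxy⟩ := he
  rw [endsD_of_notMem hde] at hxy
  unfold flipOH
  apply flipIn_of_notMem
  exact not_mem_within_OsetH_of_mem_touches ⟨x, U2_endsD_subset_UH ρ hx, y, hxy⟩

omit [Fintype V] [DecidableEq V] [Fintype E] [DecidableEq E] in
/-- The worlds of `{r, s}` in `G − d` are preserved by the outside flip of `{r, s, d}`. -/
lemma K2_endsD_flipOH (hr : d ≠ r) (hs : d ≠ s) (ρ : Config E) :
    K2 (endsD ends d) r s (flipOH ends ({r, s, d} : Set V) ρ) = K2 (endsD ends d) r s ρ := by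
  refine expl_eq_of_eqOn_touches fun e he => ?_
  obtain ⟨x, hx, y, hxy⟩ := he
  exact (flipOH_eq_on_touches_U2 hr hs ρ (e := e) ⟨x, Or.inl hx, y, hxy⟩).symm

omit [Fintype V] [DecidableEq V] [Fintype E] [DecidableEq E] in
/-- The `W`-world of `{r, s}` in `G − d` is preserved by the outside flip of `{r, s, d}`. -/
lemma M2_endsD_flipOH (hr : d ≠ r) (hs : d ≠ s) (ρ : Config E) :
    M2 (endsD ends d) r s (flipOH ends ({r, s, d} : Set V) ρ) = M2 (endsD ends d) r s ρ := by
  refine expl_eq_of_eqOn_touches fun e he => ?_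
  obtain ⟨x, hx, y, hxy⟩ := he
  simp only [OneColourSwitch.compl]
  rw [flipOH_eq_on_touches_U2 hr hs ρ (e := e) ⟨x, Or.inr hx, y, hxy⟩]

/-- **The unit predicate is invariant under the outside flip of `{r, s, d}`.** -/
theorem unit_flipOH_iff (hr : d ≠ r) (hs : d ≠ s) (ρ₀ : Config E)
    {ρ : Config E} (hρ : ρ ∈ RepH ends p q ({r, s, d} : Set V)) :
    (∀ e ∈ touches (endsD ends d) (K2 (endsD ends d) r s (flipOH ends ({r, s, d} : Set V) ρ) ∪
        M2 (endsD ends d) r s (flipOH ends ({r, s, d} : Set V) ρ)),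
        nu (endsD ends d) r s (flipOH ends ({r, s, d} : Set V) ρ) e = ρ₀ e) ↔
      ∀ e ∈ touches (endsD ends d) (K2 (endsD ends d) r s ρ ∪ M2 (endsD ends d) r s ρ),
        nu (endsD ends d) r s ρ e = ρ₀ e := by
  rw [K2_endsD_flipOH hr hs ρ, M2_endsD_flipOH hr hs ρ, nu_endsD_eq_of_mem_RepH hr hs hρ,
    nu_endsD_eq_of_mem_RepH hr hs (flipOH_mem_RepH hρ)]
  constructor
  · intro h e he
    rw [← flipOH_eq_on_touches_U2 hr hs ρ he]
    exact h e he
  · intro h e he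
    rw [flipOH_eq_on_touches_U2 hr hs ρ he]
    exact h e he

/-- **The three-terminal sum over a unit is non-positive**: for every colouring `ρ₀`,
`Σ_{ω ∈ Sep₃ ∩ DZero₃, ω in the unit of ρ₀} σ_pq · σ_rs ≤ 0`. -/
theorem dzeroSignSumHP_unit_nonpos (p q : V) (hrd : r ≠ d) (hsd : s ≠ d) (ρ₀ : Config E) :
    dzeroSignSumHP ends p q r s ({r, s, d} : Set V)
      (fun ω => ∀ e ∈ touches (endsD ends d) (K2 (endsD ends d) r s ω ∪ M2 (endsD ends d) r s ω),
        nu (endsD ends d) r s ω e = ρ₀ e) ≤ 0 :=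
  dzeroSignSumHP_nonpos p q s (r_mem_triple r s d) _
    (fun _ hρ _ hT => unit_assignC_iff hrd.symm hsd.symm ρ₀ hρ hT)
    (fun _ hρ => unit_flipOH_iff hrd.symm hsd.symm ρ₀ hρ)

/-- **The `L`-class of a unit is non-positive** (`proofs/P3-POCKETRK.md` §5‴ (b)): for every
colouring `ρ₀`, `Σ_{ω ∈ Sep₃ ∩ DZero₃, d reached, ω in the unit of ρ₀} σ_pq · σ_rs ≤ 0`. -/
theorem dzeroSignSumHP_reached_unit_nonpos (p q : V) (hrd : r ≠ d) (hsd : s ≠ d)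
    (ρ₀ : Config E) :
    dzeroSignSumHP ends p q r s ({r, s, d} : Set V)
      (fun ω => Reached ends r s d ω ∧
        ∀ e ∈ touches (endsD ends d) (K2 (endsD ends d) r s ω ∪ M2 (endsD ends d) r s ω),
          nu (endsD ends d) r s ω e = ρ₀ e) ≤ 0 :=
  dzeroSignSumHP_nonpos p q s (r_mem_triple r s d) _
    (fun _ hρ _ hT => and_congr (reached_assignC_iff hrd hsd hT)
      (unit_assignC_iff hrd.symm hsd.symm ρ₀ hρ hT))
    (fun ρ hρ => and_congr (reached_flipOH_iff ρ) (unit_flipOH_iff hrd.symm hsd.symm ρ₀ hρ))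

end Fibre

end NoPocket

end Summit.Ventures.PercRepro2
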